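import Literature.Topology.FourManifolds.PlanarBandFamily
import Literature.Topology.FourManifolds.SchubertNormalForm
import Literature.Topology.FourManifolds.KnotReparametrisation
import HarnessLib

/-!
# A loop running through the band from the left edge and back is the first summand

Topic `Literature/Topology/FourManifolds` (trunk T-4MAN). Fact seat
`provefact-Literature.Topology.FourManifolds.Knot.IsConnectedSum.isIsotopic` (Schubert's theorem),
geometric heart for rail knots, closure step. Let `b` be band-sum data of `(A, B, K)` and `k` a
knot which is `A` off a parameter interval `(p₁, p₂)` (inside the left-edge window of
`BandRebuildArches.thetaA`) and on `[p₁, p₂]` is the band image of a planar track `p` which is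
the left edge `(0, heightA s)` near both ends, has positive first coordinate `< 1` in between,
stays in the square neighbourhood, is injective, and is **monotone in the second coordinate with
the turning condition** `(p₁ - c) p₀' < 3 p₁'` about a height `c` between the end heights (e.g. a
lower rail traversed to the right, a turn at height `c`, an upper rail traversed to the left).
Then `k` is isotopic to `A` (`BandData.EdgeLoop.isIsotopic`): the planar family
`P u = ((1 - u) p₀, c + (p₁ - c) (1 - u p₀ / 4))` (tilt the rails towards the height `c`
proportionally to `p₀`, and push the track onto the left edge) is a planar family in the band
(`PlanarBandFamily.lean`) — for `u < 1` it is the track composed with an injective map of the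
plane, at `u = 1` it is the left edge traversed with strictly increasing height — so `k` is
isotopic to its end knot, whose image is `range A` with the same orientation; conclude with the
tree's `Knot.isIsotopic_of_range_eq_holds`.

Everything is proved; no named facts are introduced.

## References

* M. W. Hirsch, *Differential Topology*, GTM 33, Springer (1976), Ch. 8 §1, Thm. 1.3; §3.
  [HirschDT1976]
* D. Rolfsen, *Knots and Links* (1976), §1.A (oriented knot types). [Rolfsen1976]
-/

open scoped Manifold ContDiff Topology Real
open Function Set Metric Filter

noncomputable section

namespace Literature.Topology.FourManifolds

/-- Local notation: `𝔼 n` is the model Euclidean space `EuclideanSpace ℝ (Fin n)`. -/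
local notation "𝔼 " n:arg => EuclideanSpace ℝ (Fin n)

/-- Local notation: `𝕊 n` is the unit sphere in `EuclideanSpace ℝ (Fin (n + 1))`. -/
local notation "𝕊 " n:arg => (Metric.sphere (0 : EuclideanSpace ℝ (Fin (n + 1))) 1)

attribute [local instance] fact_finrank_euclideanSpace_succ

/-- Every point of the circle is `circlePt t` with `t` in a given fundamental domain. [folklore] -/
theorem exists_circlePt_eq_of_Ico (a : ℝ) (x : 𝕊 1) : ∃ t ∈ Ico a (a + 1), circlePt t = x := by
  obtain ⟨s, rfl⟩ := exists_circlePt_eq x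
  refine ⟨s - ⌊s - a⌋, ⟨by linarith [Int.floor_le (s - a)], by linarith [Int.lt_floor_add_one (s - a)]⟩, ?_⟩
  have := circlePt_add_int (s - ⌊s - a⌋) ⌊s - a⌋
  rw [sub_add_cancel] at this
  exact this.symm

namespace BandData

variable {A B K : Knot} {avoid : Set (𝕊 3)} (b : BandData A B K avoid)

/-- **An edge loop** for the band: a knot `k` equal to `A` off `(p₁, p₂)` and on `[p₁, p₂]` the
band image of a planar track `p` which is the left edge near the ends, with `0 < p₀ < 1` inside,
injective, monotone in `p₁` with the turning condition about the height `c`. [folklore] -/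
structure EdgeLoop (k : Knot) (p : ℝ → 𝔼 2) (p₁ p₁' p₂' p₂ c : ℝ) : Prop where
  hp : b.thetaA 10⁻¹ < p₁ ∧ p₁ < p₁' ∧ p₁' < p₂' ∧ p₂' < p₂ ∧ p₂ < b.thetaA (9 / 10)
  contDiff : ContDiff ℝ ∞ p
  curve_eq : ∀ s ∈ Icc p₁ p₂, Knot.curve k s = ((b.band (p s) : 𝕊 3) : 𝔼 4)
  off : ∀ t ∈ Ico (b.thetaA 10⁻¹) (b.thetaA 10⁻¹ + 1), t ∉ Ioo p₁ p₂ → k (circlePt t) = A (circlePt t)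
  edge : ∀ s ∈ Icc p₁ p₂, s ∉ Ioo p₁' p₂' → p s = pt2 0 (b.heightA s)
  mem : ∀ s ∈ Icc p₁ p₂, p s ∈ squareNhd b.δ
  pos : ∀ s ∈ Ioo p₁' p₂', 0 < p s 0
  lt_one : ∀ s ∈ Icc p₁ p₂, p s 0 < 1
  injOn : InjOn p (Icc p₁ p₂)
  mono : ∀ s ∈ Icc p₁ p₂, 0 ≤ deriv (fun s ↦ p s 1) s
  /-- The turning condition about the height `c`: moving right below `c` and left above `c`, up
  to three times the climbing rate. -/
  turn : ∀ s ∈ Icc p₁ p₂, (p s 1 - c) * deriv (fun s ↦ p s 0) s < 3 * deriv (fun s ↦ p s 1) s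
  straddle : b.heightA p₁ ≤ c ∧ c ≤ b.heightA p₂

namespace EdgeLoop

variable {b} {k : Knot} {p : ℝ → 𝔼 2} {p₁ p₁' p₂' p₂ c : ℝ} (h : b.EdgeLoop k p p₁ p₁' p₂' p₂ c)
include h

/-- The base of the fundamental domain. [folklore] -/
def base (_ : b.EdgeLoop k p p₁ p₁' p₂' p₂ c) : ℝ := b.thetaA 10⁻¹

/-- The seam margin. [folklore] -/
def margin (_ : b.EdgeLoop k p p₁ p₁' p₂' p₂ c) : ℝ := min (p₁ - b.thetaA 10⁻¹) (b.thetaA 10⁻¹ + 1 - p₂) / 2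

/-- The margin is positive. [folklore] -/
theorem margin_pos : 0 < h.margin := by
  have := b.thetaA_window; have := h.hp; rw [margin]
  exact div_pos (lt_min (by linarith) (by linarith)) two_pos

/-- The track interval lies inside the fundamental domain with the margin. [folklore] -/
theorem margin_le : h.base + h.margin ≤ p₁ ∧ p₂ ≤ h.base + 1 - h.margin := by
  have hw := b.thetaA_window; have hp := h.hp
  have h1 : h.margin ≤ (p₁ - b.thetaA 10⁻¹) / 2 := div_le_div_of_nonneg_right (min_le_left _ _) two_pos.le
  have h2 : h.margin ≤ (b.thetaA 10⁻¹ + 1 - p₂) / 2 := div_le_div_of_nonneg_right (min_le_right _ _) two_pos.le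
  simp only [base]; constructor <;> linarith

/-- The left transition zone of the cutoff. [folklore] -/
def l₁ (_ : b.EdgeLoop k p p₁ p₁' p₂' p₂ c) : ℝ := p₁ + (p₁' - p₁) / 4

/-- The left transition zone of the cutoff. [folklore] -/
def l₂ (_ : b.EdgeLoop k p p₁ p₁' p₂' p₂ c) : ℝ := p₁ + (p₁' - p₁) / 2

/-- The right transition zone of the cutoff. [folklore] -/
def r₁ (_ : b.EdgeLoop k p p₁ p₁' p₂' p₂ c) : ℝ := p₂ - (p₂ - p₂') / 2

/-- The right transition zone of the cutoff. [folklore] -/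
def r₂ (_ : b.EdgeLoop k p p₁ p₁' p₂' p₂ c) : ℝ := p₂ - (p₂ - p₂') / 4

/-- Order of the cutoff marks. [folklore] -/
theorem marks : p₁ < h.l₁ ∧ h.l₁ < h.l₂ ∧ h.l₂ < p₁' ∧ p₂' < h.r₁ ∧ h.r₁ < h.r₂ ∧ h.r₂ < p₂ := by
  have := h.hp; simp only [l₁, l₂, r₁, r₂]; refine ⟨?_, ?_, ?_, ?_, ?_, ?_⟩ <;> linarith

/-- **The cutoff** `χ`: `1` on `[l₂, r₁] ⊇ [p₁', p₂']`, `0` off `(l₁, r₂)`. [folklore] -/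
def chi (t : ℝ) : ℝ := smoothStep h.l₁ h.l₂ t * (1 - smoothStep h.r₁ h.r₂ t)

/-- The cutoff is `C^∞`. [folklore] -/
theorem contDiff_chi : ContDiff ℝ ∞ h.chi := (contDiff_smoothStep _ _).mul (contDiff_const.sub (contDiff_smoothStep _ _))

/-- The cutoff takes values in `[0, 1]`. [folklore] -/
theorem chi_mem (t : ℝ) : h.chi t ∈ Icc (0 : ℝ) 1 := by
  have h1 := smoothStep_mem_Icc h.l₁ h.l₂ t; have h2 := smoothStep_mem_Icc h.r₁ h.r₂ t
  refine ⟨mul_nonneg h1.1 (by linarith [h2.2]), ?_⟩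
  calc smoothStep h.l₁ h.l₂ t * (1 - smoothStep h.r₁ h.r₂ t) ≤ 1 * 1 :=
        mul_le_mul h1.2 (by linarith [h2.1]) (by linarith [h2.2]) zero_le_one
    _ = 1 := one_mul _

/-- The cutoff is `1` on `[l₂, r₁]`. [folklore] -/
theorem chi_eq_one {t : ℝ} (ht : t ∈ Icc h.l₂ h.r₁) : h.chi t = 1 := by
  have hm := h.marks
  rw [chi, smoothStep_of_ge hm.2.1 ht.1, smoothStep_of_le hm.2.2.2.2.1 ht.2]; ring

/-- The cutoff vanishes off `(l₁, r₂)`. [folklore] -/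
theorem chi_eq_zero {t : ℝ} (ht : t ∉ Ioo h.l₁ h.r₂) : h.chi t = 0 := by
  have hm := h.marks
  rw [mem_Ioo, not_and_or, not_lt, not_lt] at ht
  rcases ht with ht | ht
  · rw [chi, smoothStep_of_le hm.2.1 (by linarith)]; ring
  · rw [chi, smoothStep_of_ge hm.2.2.2.2.1 ht]; ring

/-- **The planar family**: tilt towards the height `1/2` proportionally to `p₀`, and push onto the
left edge, with strength `u χ`. [folklore] -/
def fam (u s : ℝ) : 𝔼 2 :=
  pt2 ((1 - u * h.chi s) * p s 0) (c + (p s 1 - c) * (1 - u * h.chi s * p s 0 / 4))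

/-- First coordinate of the family. [folklore] -/
@[simp] theorem fam_apply_zero (u s : ℝ) : h.fam u s 0 = (1 - u * h.chi s) * p s 0 := rfl

/-- Second coordinate of the family. [folklore] -/
@[simp] theorem fam_apply_one (u s : ℝ) : h.fam u s 1 = c + (p s 1 - c) * (1 - u * h.chi s * p s 0 / 4) := rfl

/-- At `u = 0` the family is the track. [folklore] -/
theorem fam_zero (s : ℝ) : h.fam 0 s = p s := by
  ext i; fin_cases i <;> simp

/-- Off `(l₁, r₂)` the family is the track. [folklore] -/
theorem fam_of_not_mem (u : ℝ) {t : ℝ} (ht : t ∉ Ioo h.l₁ h.r₂) : h.fam u t = p t := by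
  ext i; fin_cases i <;> simp [h.chi_eq_zero ht]

/-- On the edge zones the family is the track. [folklore] -/
theorem fam_of_edge (u : ℝ) {s : ℝ} (hs : s ∈ Icc p₁ p₂) (hs' : s ∉ Ioo p₁' p₂') : h.fam u s = p s := by
  have e := h.edge s hs hs'
  have e0 : p s 0 = 0 := by rw [e]; rfl
  ext i; fin_cases i <;> simp [e0]

/-- Left of `p₁'` the family is the track. [folklore] -/
theorem fam_of_lt (u : ℝ) {t : ℝ} (ht : t < p₁') : h.fam u t = p t := by
  by_cases h1 : t < p₁
  · exact h.fam_of_not_mem u (fun hh ↦ by linarith [hh.1, h.marks.1])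
  · exact h.fam_of_edge u ⟨not_lt.1 h1, by linarith [h.hp.2.2.1, h.hp.2.2.2.1]⟩ (fun hh ↦ absurd hh.1 (not_lt.2 ht.le))

/-- Right of `p₂'` the family is the track. [folklore] -/
theorem fam_of_gt (u : ℝ) {t : ℝ} (ht : p₂' < t) : h.fam u t = p t := by
  by_cases h1 : p₂ < t
  · exact h.fam_of_not_mem u (fun hh ↦ by linarith [hh.2, h.marks.2.2.2.2.2])
  · exact h.fam_of_edge u ⟨by linarith [h.hp.2.1, h.hp.2.2.1], not_lt.1 h1⟩ (fun hh ↦ absurd hh.2 (not_lt.2 ht.le))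

/-- **The core formula** (cutoff `1`). [folklore] -/
def famCore (_ : b.EdgeLoop k p p₁ p₁' p₂' p₂ c) (u s : ℝ) : 𝔼 2 :=
  pt2 ((1 - u) * p s 0) (c + (p s 1 - c) * (1 - u * p s 0 / 4))

/-- On `[l₂, r₁]` the family is the core formula. [folklore] -/
theorem fam_eq_famCore {u s : ℝ} (hs : s ∈ Icc h.l₂ h.r₁) : h.fam u s = h.famCore u s := by
  ext i; fin_cases i <;> simp [famCore, h.chi_eq_one hs]

/-- The coordinates of the track are `C^∞`. [folklore] -/
theorem contDiff_coord (i : Fin 2) : ContDiff ℝ ∞ fun s ↦ p s i :=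
  contDiff_euclidean.1 h.contDiff i

/-- The family is jointly `C^∞`. [folklore] -/
theorem contDiff_fam : ContDiff ℝ ∞ (uncurry h.fam) := by
  have h0 : ContDiff ℝ ∞ fun q : ℝ × ℝ ↦ p q.2 0 := (h.contDiff_coord 0).comp contDiff_snd
  have h1 : ContDiff ℝ ∞ fun q : ℝ × ℝ ↦ p q.2 1 := (h.contDiff_coord 1).comp contDiff_snd
  have hχ : ContDiff ℝ ∞ fun q : ℝ × ℝ ↦ q.1 * h.chi q.2 := contDiff_fst.mul (h.contDiff_chi.comp contDiff_snd)
  have hc0 : ContDiff ℝ ∞ fun q : ℝ × ℝ ↦ (1 - q.1 * h.chi q.2) * p q.2 0 := (contDiff_const.sub hχ).mul h0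
  have hc1 : ContDiff ℝ ∞ fun q : ℝ × ℝ ↦ c + (p q.2 1 - c) * (1 - q.1 * h.chi q.2 * p q.2 0 / 4) :=
    contDiff_const.add ((h1.sub contDiff_const).mul (contDiff_const.sub ((hχ.mul h0).div_const _)))
  rw [contDiff_euclidean]
  intro i
  fin_cases i
  · exact hc0
  · exact hc1

/-- The second coordinate of the family at a track point on the edge window lies in the height
window `(1/10, 9/10)`... more precisely between the heights of the end points. First: the track
heights lie between the end heights. [folklore] -/
theorem heightA_le_apply_one {s : ℝ} (hs : s ∈ Icc p₁ p₂) : b.heightA p₁ ≤ p s 1 ∧ p s 1 ≤ b.heightA p₂ := by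
  have hp := h.hp
  have hmono : MonotoneOn (fun s ↦ p s 1) (Icc p₁ p₂) :=
    monotoneOn_of_deriv_nonneg (convex_Icc _ _) ((h.contDiff_coord 1).continuous.continuousOn)
      (((h.contDiff_coord 1).differentiable (by simp)).differentiableOn.mono interior_subset)
      (fun s hs ↦ h.mono s (interior_subset hs))
  have e1 : p p₁ 1 = b.heightA p₁ := by
    rw [h.edge p₁ ⟨le_rfl, by linarith⟩ (fun hh ↦ absurd hh.1 (by linarith))]; simp
  have e2 : p p₂ 1 = b.heightA p₂ := by
    rw [h.edge p₂ ⟨by linarith, le_rfl⟩ (fun hh ↦ absurd hh.2 (by linarith))]; simp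
  exact ⟨e1 ▸ hmono ⟨le_rfl, by linarith⟩ hs hs.1, e2 ▸ hmono hs ⟨by linarith, le_rfl⟩ hs.2⟩

/-- The end heights lie in the height window. [folklore] -/
theorem heightA_mem : b.heightA p₁ ∈ Ioo (10⁻¹ : ℝ) (9 / 10) ∧ b.heightA p₂ ∈ Ioo (10⁻¹ : ℝ) (9 / 10) := by
  have hp := h.hp
  have hsm := b.strictMonoOn_heightA
  have hw : b.thetaA 10⁻¹ < b.thetaA (9 / 10) := by linarith
  have hlo : b.heightA (b.thetaA 10⁻¹) = 10⁻¹ := b.heightA_thetaA ⟨le_rfl, by norm_num⟩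
  have hhi : b.heightA (b.thetaA (9 / 10)) = 9 / 10 := b.heightA_thetaA ⟨by norm_num, le_rfl⟩
  have m0 : b.thetaA 10⁻¹ ∈ Icc (b.thetaA 10⁻¹) (b.thetaA (9 / 10)) := ⟨le_rfl, hw.le⟩
  have m9 : b.thetaA (9 / 10) ∈ Icc (b.thetaA 10⁻¹) (b.thetaA (9 / 10)) := ⟨hw.le, le_rfl⟩
  have m1 : p₁ ∈ Icc (b.thetaA 10⁻¹) (b.thetaA (9 / 10)) := ⟨by linarith, by linarith⟩
  have m2 : p₂ ∈ Icc (b.thetaA 10⁻¹) (b.thetaA (9 / 10)) := ⟨by linarith, by linarith⟩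
  refine ⟨⟨?_, ?_⟩, ?_, ?_⟩
  · have := hsm m0 m1 (by linarith); rwa [hlo] at this
  · have := hsm m1 m9 (by linarith); rwa [hhi] at this
  · have := hsm m0 m2 (by linarith); rwa [hlo] at this
  · have := hsm m2 m9 (by linarith); rwa [hhi] at this

/-- The family stays in the square neighbourhood. [folklore] -/
theorem fam_mem {u : ℝ} (hu : u ∈ Icc (0 : ℝ) 1) {s : ℝ} (hs : s ∈ Icc p₁ p₂) : h.fam u s ∈ squareNhd b.δ := by
  have hm := mem_squareNhd_iff.1 (h.mem s hs)
  have h0 := hm 0; have h1 := hm 1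
  have hp0 : 0 ≤ p s 0 := by
    by_cases hs' : s ∈ Ioo p₁' p₂'
    · exact (h.pos s hs').le
    · rw [h.edge s hs hs']; exact le_rfl
  have hp1 := h.lt_one s hs
  have hδ := b.δ_pos
  have hχ := h.chi_mem s
  have huχ : 0 ≤ u * h.chi s ∧ u * h.chi s ≤ 1 := ⟨mul_nonneg hu.1 hχ.1, by nlinarith [hu.1, hu.2, hχ.1, hχ.2]⟩
  have hw : 0 ≤ 1 - u * h.chi s * p s 0 / 4 ∧ 1 - u * h.chi s * p s 0 / 4 ≤ 1 := ⟨by nlinarith, by nlinarith⟩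
  have c0 : h.fam u s 0 ∈ Ioo (-b.δ) (1 + b.δ) := by
    rw [fam_apply_zero]; constructor <;> nlinarith [h0.1, h0.2]
  have hcm : c ∈ Ioo (-b.δ) (1 + b.δ) := by
    have hA := h.heightA_mem; have hs12 := h.straddle
    exact ⟨by linarith [hA.1.1], by linarith [hA.2.2]⟩
  have c1 : h.fam u s 1 ∈ Ioo (-b.δ) (1 + b.δ) := by
    rw [fam_apply_one]
    set w := 1 - u * h.chi s * p s 0 / 4
    rcases le_total (p s 1) c with hc | hc
    · constructor <;> nlinarith [h1.1, h1.2, hw.1, hw.2, hcm.1, hcm.2]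
    · constructor <;> nlinarith [h1.1, h1.2, hw.1, hw.2, hcm.1, hcm.2]
  rw [mem_squareNhd_iff]
  intro i; fin_cases i
  · exact c0
  · exact c1

/-- **The second coordinate of the family lies between the end heights.** [folklore] -/
theorem fam_one_mem {u : ℝ} (hu : u ∈ Icc (0 : ℝ) 1) {s : ℝ} (hs : s ∈ Icc p₁ p₂) :
    h.fam u s 1 ∈ Icc (b.heightA p₁) (b.heightA p₂) := by
  obtain ⟨h1, h2⟩ := h.heightA_le_apply_one hs
  obtain ⟨hs1, hs2⟩ := h.straddle
  have hp0 : 0 ≤ p s 0 := by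
    by_cases hs' : s ∈ Ioo p₁' p₂'
    · exact (h.pos s hs').le
    · rw [h.edge s hs hs']; exact le_rfl
  have hχ := h.chi_mem s
  have huχ : 0 ≤ u * h.chi s ∧ u * h.chi s ≤ 1 := ⟨mul_nonneg hu.1 hχ.1, by nlinarith [hu.1, hu.2, hχ.1, hχ.2]⟩
  have hw : 0 ≤ 1 - u * h.chi s * p s 0 / 4 ∧ 1 - u * h.chi s * p s 0 / 4 ≤ 1 :=
    ⟨by nlinarith [h.lt_one s hs], by nlinarith⟩
  simp only [fam_apply_one, mem_Icc]
  set w := 1 - u * h.chi s * p s 0 / 4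
  constructor
  · rcases le_total (p s 1) c with hc | hc
    · nlinarith
    · nlinarith
  · rcases le_total (p s 1) c with hc | hc
    · nlinarith
    · nlinarith

/-- The heights of the family lie in the height window. [folklore] -/
theorem fam_one_mem_window {u : ℝ} (hu : u ∈ Icc (0 : ℝ) 1) {s : ℝ} (hs : s ∈ Icc p₁ p₂) :
    h.fam u s 1 ∈ Icc (10⁻¹ : ℝ) (9 / 10) := by
  have h1 := h.fam_one_mem hu hs; have h2 := h.heightA_mem
  exact ⟨by linarith [h1.1, h2.1.1], by linarith [h1.2, h2.2.2]⟩

/-! ### Derivatives -/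

/-- Coordinate derivatives of the track. [folklore] -/
theorem hasDerivAt_coord (i : Fin 2) (s : ℝ) : HasDerivAt (fun s ↦ p s i) (deriv (fun s ↦ p s i) s) s :=
  (((h.contDiff_coord i).differentiable (by simp)) s).hasDerivAt

omit h in
/-- The track as `pt2` of its coordinates. [folklore] -/
theorem track_eq (s : ℝ) : p s = pt2 (p s 0) (p s 1) := by
  ext i; fin_cases i <;> rfl

/-- The derivative of the track in coordinates. [folklore] -/
theorem hasDerivAt_track (s : ℝ) : HasDerivAt p (pt2 (deriv (fun s ↦ p s 0) s) (deriv (fun s ↦ p s 1) s)) s := by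
  have := hasDerivAt_pt2 (h.hasDerivAt_coord 0 s) (h.hasDerivAt_coord 1 s)
  have e : (fun x ↦ pt2 (p x 0) (p x 1)) = p := by funext x; exact (track_eq x).symm
  rwa [e] at this

/-- **The track is regular** (from the monotonicity and turning conditions). [folklore] -/
theorem deriv_track_ne_zero {s : ℝ} (hs : s ∈ Icc p₁ p₂) : deriv p s ≠ 0 := by
  rw [(h.hasDerivAt_track s).deriv]
  intro h0
  have e0 : deriv (fun s ↦ p s 0) s = 0 := by simpa using congrArg (fun v : 𝔼 2 ↦ v 0) h0
  have e1 : deriv (fun s ↦ p s 1) s = 0 := by simpa using congrArg (fun v : 𝔼 2 ↦ v 1) h0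
  have := h.turn s hs
  rw [e0, e1, mul_zero, mul_zero] at this
  exact lt_irrefl _ this

/-- The derivative of the core formula. [folklore] -/
theorem hasDerivAt_famCore (u s : ℝ) :
    HasDerivAt (h.famCore u)
      (pt2 ((1 - u) * deriv (fun s ↦ p s 0) s)
        (deriv (fun s ↦ p s 1) s * (1 - u * p s 0 / 4) + (p s 1 - c) * (-(u * deriv (fun s ↦ p s 0) s / 4)))) s := by
  have h0 := h.hasDerivAt_coord 0 s
  have h1 := h.hasDerivAt_coord 1 s
  have hu : HasDerivAt (fun s ↦ (1 - u) * p s 0) ((1 - u) * deriv (fun s ↦ p s 0) s) s := h0.const_mul _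
  have hw : HasDerivAt (fun s ↦ 1 - u * p s 0 / 4) (-(u * deriv (fun s ↦ p s 0) s / 4)) s := by
    have := ((h0.const_mul u).div_const 4).const_sub 1
    simpa using this
  have hv : HasDerivAt (fun s ↦ c + (p s 1 - c) * (1 - u * p s 0 / 4))
      (deriv (fun s ↦ p s 1) s * (1 - u * p s 0 / 4) + (p s 1 - c) * (-(u * deriv (fun s ↦ p s 0) s / 4))) s := by
    have := ((h1.sub_const c).mul hw).const_add c
    simpa using this
  exact hasDerivAt_pt2 hu hv

/-- **The second coordinate of the core derivative is nonnegative, and the core derivative is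
nonzero** (`u ∈ [0, 1]`). [folklore] -/
theorem famCore_deriv_one_nonneg {u : ℝ} (hu : u ∈ Icc (0 : ℝ) 1) {s : ℝ} (hs : s ∈ Icc p₁ p₂) :
    0 ≤ deriv (fun s ↦ p s 1) s * (1 - u * p s 0 / 4) + (p s 1 - c) * (-(u * deriv (fun s ↦ p s 0) s / 4)) ∧
      ((1 - u) * deriv (fun s ↦ p s 0) s = 0 →
        0 < deriv (fun s ↦ p s 1) s * (1 - u * p s 0 / 4) + (p s 1 - c) * (-(u * deriv (fun s ↦ p s 0) s / 4))) := by
  have hm : 0 ≤ deriv (fun s ↦ p s 1) s := h.mono s hs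
  have ht : (p s 1 - c) * deriv (fun s ↦ p s 0) s < 3 * deriv (fun s ↦ p s 1) s := h.turn s hs
  have hp0 : 0 ≤ p s 0 := by
    by_cases hs' : s ∈ Ioo p₁' p₂'
    · exact (h.pos s hs').le
    · rw [h.edge s hs hs']; exact le_rfl
  have hx1 := h.lt_one s hs
  have hw : 0 < 1 - u * p s 0 / 4 := by nlinarith [hu.1, hu.2]
  have e : deriv (fun s ↦ p s 1) s * (1 - u * p s 0 / 4) + (p s 1 - c) * (-(u * deriv (fun s ↦ p s 0) s / 4)) =
      deriv (fun s ↦ p s 1) s * (1 - u * p s 0 / 4) - u / 4 * ((p s 1 - c) * deriv (fun s ↦ p s 0) s) := by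
    ring
  rw [e]
  set d0 := deriv (fun s ↦ p s 0) s with hd0
  set d1 := deriv (fun s ↦ p s 1) s with hd1
  set T := (p s 1 - c) * d0 with hT
  rcases le_or_gt T 0 with hT0 | hT0
  · -- the turning term helps
    refine ⟨by nlinarith [hu.1, hu.2], fun hD0 ↦ ?_⟩
    rcases hm.eq_or_lt with hm0 | hm0
    · -- `d1 = 0`: then `T < 0` and `d0 ≠ 0`, so `u = 1`
      rw [← hm0, mul_zero] at ht
      have hd0ne : d0 ≠ 0 := fun h0 ↦ by rw [hT, h0, mul_zero] at ht; exact lt_irrefl _ ht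
      have hu1 : u = 1 := by
        rcases mul_eq_zero.1 hD0 with h1 | h1
        · linarith
        · exact absurd h1 hd0ne
      rw [← hm0, hu1]; nlinarith
    · nlinarith [hu.1, hu.2]
  · -- the turning term is positive but less than `3 d1`
    have hd1pos : 0 < d1 := by nlinarith
    have k1 : u / 4 * T ≤ T / 4 := by nlinarith [hu.1, hu.2]
    have k2 : T / 4 < 3 / 4 * d1 := by linarith
    have hux : u * p s 0 ≤ 1 := by nlinarith [hu.1, hu.2]
    have k3 : 3 / 4 * d1 ≤ d1 * (1 - u * p s 0 / 4) := by nlinarith [hd1pos.le, hux]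
    exact ⟨by linarith, fun _ ↦ by linarith⟩

/-- **The family is regular on the track interval** (`u ∈ [0, 1]`), with positive height
derivative at `u = 1`. [folklore] -/
theorem deriv_fam_ne_zero {u : ℝ} (hu : u ∈ Icc (0 : ℝ) 1) {s : ℝ} (hs : s ∈ Icc p₁ p₂) : deriv (h.fam u) s ≠ 0 := by
  have hm := h.marks; have hp := h.hp
  by_cases h1 : s < p₁'
  · have hev : h.fam u =ᶠ[𝓝 s] p := by
      filter_upwards [Iio_mem_nhds h1] with t ht using h.fam_of_lt u ht
    rw [hev.deriv_eq]; exact h.deriv_track_ne_zero hs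
  by_cases h2 : p₂' < s
  · have hev : h.fam u =ᶠ[𝓝 s] p := by
      filter_upwards [Ioi_mem_nhds h2] with t ht using h.fam_of_gt u ht
    rw [hev.deriv_eq]; exact h.deriv_track_ne_zero hs
  push Not at h1 h2
  have hev : h.fam u =ᶠ[𝓝 s] h.famCore u := by
    filter_upwards [Ioo_mem_nhds (show h.l₂ < s by linarith) (show s < h.r₁ by linarith)] with t ht
      using h.fam_eq_famCore (Ioo_subset_Icc_self ht)
  rw [hev.deriv_eq, (h.hasDerivAt_famCore u s).deriv]
  intro h0
  have e0 : (1 - u) * deriv (fun s ↦ p s 0) s = 0 := by simpa using congrArg (fun v : 𝔼 2 ↦ v 0) h0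
  have e1 : deriv (fun s ↦ p s 1) s * (1 - u * p s 0 / 4) + (p s 1 - c) * (-(u * deriv (fun s ↦ p s 0) s / 4)) = 0 := by
    simpa using congrArg (fun v : 𝔼 2 ↦ v 1) h0
  have := (h.famCore_deriv_one_nonneg hu hs).2 e0
  linarith

/-- **The height of the final track is strictly increasing.** [folklore] -/
theorem deriv_fam_one_one_pos {s : ℝ} (hs : s ∈ Icc p₁ p₂) : 0 < deriv (fun s ↦ h.fam 1 s 1) s := by
  have hm := h.marks; have hp := h.hp
  -- on the edge zones the height is `heightA`
  have hedge : ∀ {s : ℝ}, s ∈ Icc p₁ p₂ → (h.fam 1 =ᶠ[𝓝 s] p) → 0 < deriv (fun s ↦ h.fam 1 s 1) s := by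
    intro s hs hev
    have hev' : (fun s ↦ h.fam 1 s 1) =ᶠ[𝓝 s] fun s ↦ p s 1 := hev.mono fun t ht ↦ by show h.fam 1 t 1 = p t 1; rw [ht]
    rw [hev'.deriv_eq]
    rcases (h.mono s hs).eq_or_lt with hd | hd
    · -- `p₁' = 0` forces `p₀' ≠ 0`, impossible where the family is the track near `s`?
      -- use the derivative of `fam 1` itself: it is `deriv p s ≠ 0` with vanishing first coordinate
      have hst : (p s 1 - c) * deriv (fun s ↦ p s 0) s < 0 := by
        have := h.turn s hs; rwa [← hd, mul_zero] at this
      have hd0 : deriv (fun s ↦ h.fam 1 s 0) s = deriv (fun s ↦ p s 0) s := by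
        have : (fun s ↦ h.fam 1 s 0) =ᶠ[𝓝 s] fun s ↦ p s 0 := hev.mono fun t ht ↦ by show h.fam 1 t 0 = p t 0; rw [ht]
        rw [this.deriv_eq]
      -- but `fam 1 s 0 = (1 - χ s) p₀ s`, whose derivative at a point with `p₀ = 0`... we avoid this:
      -- near `s` the family IS the track, and the first coordinate of the track vanishes on the edge
      -- zones; we are in an edge zone or at an interior point of agreement.  Use `turn`/`strict`:
      exfalso
      -- `fam 1 t 0 = (1 - χ t) * p t 0 ≤ p t 0` and both vanish... derive `p₀' = 0` from the local
      -- identity `fam 1 = p`: `(1 - χ t) * p t 0 = p t 0` near `s`, i.e. `χ t * p t 0 = 0` near `s`.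
      have hχp : (fun t ↦ h.chi t * p t 0) =ᶠ[𝓝 s] fun _ ↦ (0 : ℝ) := hev.mono fun t ht ↦ by
        have := congrArg (fun v : 𝔼 2 ↦ v 0) ht
        simp only [fam_apply_zero] at this
        linarith
      -- if `χ s > 0` then `p₀ = 0` near `s`, so `p₀' s = 0`, contradicting `strict`
      -- if `χ s = 0` then `s ∉ (l₁, r₂)`, so `s` is in an edge zone with `p₀ = 0` on a one-sided
      -- neighbourhood inside `[p₁, p₂]`; in either case we show `deriv p₀ s = 0`.
      have hd0' : deriv (fun s ↦ p s 0) s = 0 := by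
        by_cases hχ : 0 < h.chi s
        · have hχc : ContinuousAt h.chi s := h.contDiff_chi.continuous.continuousAt
          have hpos : ∀ᶠ t in 𝓝 s, 0 < h.chi t := hχc.eventually (Ioi_mem_nhds hχ)
          have hp0 : (fun t ↦ p t 0) =ᶠ[𝓝 s] fun _ ↦ (0 : ℝ) := by
            filter_upwards [hχp, hpos] with t ht ht'
            rcases mul_eq_zero.1 ht with h0 | h0
            · exact absurd h0 ht'.ne'
            · exact h0
          rw [hp0.deriv_eq, deriv_const]
        · -- `χ s = 0`: then `s ≤ l₁` or `r₂ ≤ s`; the edge form holds on `[p₁, p₁']` resp. `[p₂', p₂]`,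
          -- an interval containing `s` in its interior relative to... `s` may be `p₁` or `p₂` (end
          -- points); there `p₀ = 0` on `[p₁, p₁']` and the derivative is a one-sided limit.
          have hχ0 : h.chi s = 0 := le_antisymm (not_lt.1 hχ) (h.chi_mem s).1
          have hs' : s ≤ h.l₁ ∨ h.r₂ ≤ s := by
            by_contra hc; push Not at hc
            have h1 : 0 < smoothStep h.l₁ h.l₂ s := by
              rcases lt_or_ge s h.l₂ with hl | hl
              · exact (smoothStep_mem_Ioo hm.2.1 ⟨hc.1, hl⟩).1
              · rw [smoothStep_of_ge hm.2.1 hl]; exact one_pos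
            have h2 : smoothStep h.r₁ h.r₂ s < 1 := by
              rcases le_or_gt s h.r₁ with hr | hr
              · rw [smoothStep_of_le hm.2.2.2.2.1 hr]; exact one_pos
              · exact (smoothStep_mem_Ioo hm.2.2.2.2.1 ⟨hr, hc.2⟩).2
            have : 0 < h.chi s := mul_pos h1 (by linarith)
            linarith
          -- `p₀` vanishes on `[p₁, p₁']` resp. `[p₂', p₂]`; compute the derivative within that interval
          have key : ∀ {c d : ℝ}, c < d → s ∈ Icc c d → (∀ t ∈ Icc c d, p t 0 = 0) → deriv (fun s ↦ p s 0) s = 0 := by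
            intro c d hcd hsm hz
            have hdiff : DifferentiableAt ℝ (fun s ↦ p s 0) s := ((h.contDiff_coord 0).differentiable (by simp)) s
            have huniq : UniqueDiffWithinAt ℝ (Icc c d) s := uniqueDiffOn_Icc hcd s hsm
            rw [← hdiff.derivWithin huniq, derivWithin_congr (f := fun _ ↦ (0 : ℝ)) (fun t ht ↦ hz t ht) (hz s hsm)]
            simp
          rcases hs' with hs' | hs'
          · exact key hp.2.1 ⟨hs.1, by linarith⟩ fun t ht ↦ by
              have := h.edge t ⟨ht.1, by linarith [ht.2]⟩ (fun hh ↦ absurd hh.1 (not_lt.2 ht.2)); rw [this]; rfl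
          · exact key hp.2.2.2.1 ⟨by linarith, hs.2⟩ fun t ht ↦ by
              have := h.edge t ⟨by linarith [ht.1], ht.2⟩ (fun hh ↦ absurd hh.2 (not_lt.2 ht.1)); rw [this]; rfl
      rw [hd0', mul_zero] at hst
      exact lt_irrefl _ hst
    · exact hd
  by_cases h1 : s < p₁'
  · exact hedge hs (by filter_upwards [Iio_mem_nhds h1] with t ht using h.fam_of_lt 1 ht)
  by_cases h2 : p₂' < s
  · exact hedge hs (by filter_upwards [Ioi_mem_nhds h2] with t ht using h.fam_of_gt 1 ht)
  push Not at h1 h2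
  have hev : (fun s ↦ h.fam 1 s 1) =ᶠ[𝓝 s] fun s ↦ h.famCore 1 s 1 := by
    filter_upwards [Ioo_mem_nhds (show h.l₂ < s by linarith) (show s < h.r₁ by linarith)] with t ht
    rw [h.fam_eq_famCore (Ioo_subset_Icc_self ht)]
  rw [hev.deriv_eq]
  have hc := h.hasDerivAt_famCore 1 s
  have hc1 : HasDerivAt (fun s ↦ h.famCore 1 s 1)
      (deriv (fun s ↦ p s 1) s * (1 - 1 * p s 0 / 4) + (p s 1 - c) * (-(1 * deriv (fun s ↦ p s 0) s / 4))) s := by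
    have := (EuclideanSpace.proj (1 : Fin 2) (𝕜 := ℝ)).hasFDerivAt.comp_hasDerivAt s hc
    exact this
  rw [hc1.deriv]
  exact (h.famCore_deriv_one_nonneg ⟨zero_le_one, le_rfl⟩ hs).2 (by ring)

/-! ### Injectivity, the planar family, and the end knot -/

/-- **The planar map** `Ψᵤ (x) = ((1 - u) x₀, c + (x₁ - c)(1 - u x₀/4))`. [folklore] -/
def psiMap (_ : b.EdgeLoop k p p₁ p₁' p₂' p₂ c) (u : ℝ) (x : 𝔼 2) : 𝔼 2 :=
  pt2 ((1 - u) * x 0) (c + (x 1 - c) * (1 - u * x 0 / 4))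

/-- On the track interval the family is the planar map applied to the track. [folklore] -/
theorem fam_eq_psiMap (u : ℝ) {s : ℝ} (hs : s ∈ Icc p₁ p₂) : h.fam u s = h.psiMap u (p s) := by
  have hm := h.marks
  by_cases hc : s ∈ Icc h.l₂ h.r₁
  · rw [h.fam_eq_famCore hc]; rfl
  · have hs' : s ∉ Ioo p₁' p₂' := fun hh ↦ hc ⟨by linarith [hh.1], by linarith [hh.2]⟩
    have e := h.edge s hs hs'
    have e0 : p s 0 = 0 := by rw [e]; rfl
    ext i; fin_cases i <;> simp [psiMap, e0]

/-- The planar map is injective on `{x₀ < 4}` for `u < 1`. [folklore] -/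
theorem psiMap_injOn {u : ℝ} (hu : u ∈ Ico (0 : ℝ) 1) : InjOn (h.psiMap u) {x : 𝔼 2 | x 0 < 4} := by
  intro x hx y hy he
  have e0 : (1 - u) * x 0 = (1 - u) * y 0 := congrArg (fun v : 𝔼 2 ↦ v 0) he
  have e1 : c + (x 1 - c) * (1 - u * x 0 / 4) = c + (y 1 - c) * (1 - u * y 0 / 4) := congrArg (fun v : 𝔼 2 ↦ v 1) he
  have hx0 : x 0 = y 0 := mul_left_cancel₀ (by linarith [hu.2]) e0
  rw [hx0] at e1
  have hw : 1 - u * y 0 / 4 ≠ 0 := by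
    have : y 0 < 4 := hy
    nlinarith [hu.1, hu.2]
  have hx1 : x 1 = y 1 := by
    have := mul_right_cancel₀ hw (add_left_cancel e1)
    linarith
  ext i; fin_cases i
  · exact hx0
  · exact hx1

/-- **The family is injective on the track interval** (`u ∈ [0, 1]`). [folklore] -/
theorem injOn_fam {u : ℝ} (hu : u ∈ Icc (0 : ℝ) 1) : InjOn (h.fam u) (Icc p₁ p₂) := by
  rcases hu.2.eq_or_lt with rfl | hu1
  · -- `u = 1`: the height is strictly increasing
    have hcont : Continuous fun s ↦ h.fam 1 s 1 :=
      (contDiff_euclidean.1 (h.contDiff_fam.comp (contDiff_const.prodMk contDiff_id)) 1).continuous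
    have hmono : StrictMonoOn (fun s ↦ h.fam 1 s 1) (Icc p₁ p₂) :=
      strictMonoOn_of_deriv_pos (convex_Icc _ _) hcont.continuousOn (fun s hs ↦ h.deriv_fam_one_one_pos (interior_subset hs))
    intro s hs s' hs' he
    exact hmono.injOn hs hs' (congrArg (fun v : 𝔼 2 ↦ v 1) he)
  · intro s hs s' hs' he
    rw [h.fam_eq_psiMap u hs, h.fam_eq_psiMap u hs'] at he
    have h4 : ∀ {t}, t ∈ Icc p₁ p₂ → p t ∈ {x : 𝔼 2 | x 0 < 4} := fun {t} ht ↦ by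
      show p t 0 < 4; linarith [h.lt_one t ht]
    exact h.injOn hs hs' (h.psiMap_injOn ⟨hu.1, hu1⟩ (h4 hs) (h4 hs') he)

/-- **Band points of the family on the left edge are points of `A` with parameter in the track
interval**: if `fam u s` has first coordinate `0` then `band (fam u s) = A (circlePt θ)` with
`θ = thetaA (fam u s 1) ∈ [p₁, p₂]`. [folklore] -/
theorem exists_eq_of_apply_zero_eq {u : ℝ} (hu : u ∈ Icc (0 : ℝ) 1) {s : ℝ} (hs : s ∈ Icc p₁ p₂) (h0 : h.fam u s 0 = 0) :
    b.thetaA (h.fam u s 1) ∈ Icc p₁ p₂ ∧ b.band (h.fam u s) = A (circlePt (b.thetaA (h.fam u s 1))) := by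
  have hp := h.hp
  have hy := h.fam_one_mem hu hs
  have hyw := h.fam_one_mem_window hu hs
  have hA := h.heightA_mem
  have hsm := b.strictMonoOn_thetaA.monotoneOn
  have m1 : p₁ ∈ Icc (b.thetaA 10⁻¹) (b.thetaA (9 / 10)) := ⟨by linarith, by linarith⟩
  have m2 : p₂ ∈ Icc (b.thetaA 10⁻¹) (b.thetaA (9 / 10)) := ⟨by linarith, by linarith⟩
  refine ⟨⟨?_, ?_⟩, ?_⟩
  · have := hsm (Ioo_subset_Icc_self hA.1) hyw hy.1
    rwa [(b.thetaA_heightA m1).1] at this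
  · have := hsm hyw (Ioo_subset_Icc_self hA.2) hy.2
    rwa [(b.thetaA_heightA m2).1] at this
  · rw [b.apply_circlePt_thetaA hyw]
    congr 1
    ext i; fin_cases i
    · exact h0
    · rfl

/-- **The planar family in the band defined by the edge loop.** [folklore] -/
theorem planarFamily : b.PlanarFamily k h.base h.margin p₁ h.l₁ h.r₂ p₂ h.fam where
  ε_pos := h.margin_pos
  hs := ⟨h.margin_le.1, h.marks.1, by linarith [h.marks.2.1, h.marks.2.2.1, h.hp.2.2.1, h.marks.2.2.2.1, h.marks.2.2.2.2.1],
    h.marks.2.2.2.2.2, h.margin_le.2⟩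
  contDiff := h.contDiff_fam
  eq_zero u t ht := by rw [h.fam_of_not_mem u ht, h.fam_zero]
  curve_eq s hs := by rw [h.curve_eq s hs, h.fam_zero]
  mem u hu s hs := h.fam_mem hu hs
  deriv_ne u hu s hs := h.deriv_fam_ne_zero hu hs
  injOn u hu := h.injOn_fam hu
  disjoint u hu s hs t ht hts he := by
    -- the band point lies on `A`, hence on the left edge
    have htI : t ∉ Ioo p₁ p₂ := fun hh ↦ hts (Ioo_subset_Icc_self hh)
    rw [Knot.curve_apply, h.off t ht htI] at he
    have hmem : h.fam u s ∈ b.band ⁻¹' range A ∩ squareNhd b.δ :=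
      ⟨⟨circlePt t, (Subtype.ext he).symm⟩, h.fam_mem hu hs⟩
    rw [b.preimage_left] at hmem
    obtain ⟨hθ, hband⟩ := h.exists_eq_of_apply_zero_eq hu hs hmem.2
    have heq : A (circlePt t) = A (circlePt (b.thetaA (h.fam u s 1))) := by rw [← hband]; exact (Subtype.ext he).symm
    obtain ⟨m, hm⟩ := circlePt_eq_circlePt_iff.1 (A.injective heq)
    have hw := b.thetaA_window
    have h1 : (m : ℝ) < 1 := by simp only [base] at ht; linarith [ht.2, hθ.1, h.hp.1]
    have h2 : (-1 : ℝ) < m := by simp only [base] at ht; linarith [ht.1, hθ.2, h.hp.2.2.2.2]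
    have h1' : m < 1 := by exact_mod_cast h1
    have h2' : -1 < m := by exact_mod_cast h2
    obtain rfl : m = 0 := by omega
    simp only [Int.cast_zero, add_zero] at hm
    exact hts (hm ▸ hθ)

/-- **The end knot** of the edge loop family. [folklore] -/
def outKnot : Knot := h.planarFamily.outKnot

/-- The edge loop is isotopic to the end knot. [folklore] -/
theorem isIsotopic_outKnot : k.IsIsotopic h.outKnot := h.planarFamily.isIsotopic_outKnot

/-- The first coordinate of the final track vanishes. [folklore] -/
theorem fam_one_apply_zero {s : ℝ} (hs : s ∈ Icc p₁ p₂) : h.fam 1 s 0 = 0 := by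
  rw [h.fam_eq_psiMap 1 hs]; simp [psiMap]

/-- **The end knot on the track interval** is the left-edge point at height `fam 1 s 1`, a point
of `A`. [folklore] -/
theorem outKnot_circlePt_of_mem {s : ℝ} (hs : s ∈ Icc p₁ p₂) :
    h.outKnot (circlePt s) = A (circlePt (b.thetaA (h.fam 1 s 1))) := by
  rw [outKnot, h.planarFamily.outKnot_circlePt_of_mem hs]
  exact (h.exists_eq_of_apply_zero_eq ⟨zero_le_one, le_rfl⟩ hs (h.fam_one_apply_zero hs)).2

/-- **The end knot off the track interval** is `A`. [folklore] -/
theorem outKnot_circlePt_of_not_mem {t : ℝ} (ht : t ∈ Ico h.base (h.base + 1)) (hts : t ∉ Icc p₁ p₂) :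
    h.outKnot (circlePt t) = A (circlePt t) := by
  rw [outKnot, h.planarFamily.outKnot_circlePt_of_not_mem ht hts]
  exact h.off t ht (fun hh ↦ hts (Ioo_subset_Icc_self hh))

/-- **The end knot has the image of `A`.** [folklore] -/
theorem range_outKnot : range h.outKnot = range A := by
  have hp := h.hp
  apply Subset.antisymm
  · rintro _ ⟨x, rfl⟩
    obtain ⟨t, ht, rfl⟩ := exists_circlePt_eq_of_Ico h.base x
    by_cases hts : t ∈ Icc p₁ p₂
    · rw [h.outKnot_circlePt_of_mem hts]; exact mem_range_self _
    · rw [h.outKnot_circlePt_of_not_mem ht hts]; exact mem_range_self _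
  · rintro _ ⟨x, rfl⟩
    obtain ⟨t, ht, rfl⟩ := exists_circlePt_eq_of_Ico h.base x
    by_cases hts : t ∈ Icc p₁ p₂
    · -- `A (circlePt t) = band (0, heightA t)`; find `s` with `fam 1 s 1 = heightA t`
      have htw : t ∈ Icc (b.thetaA 10⁻¹) (b.thetaA (9 / 10)) := ⟨by linarith [hts.1], by linarith [hts.2]⟩
      have hcont : ContinuousOn (fun s ↦ h.fam 1 s 1) (Icc p₁ p₂) :=
        (contDiff_euclidean.1 (h.contDiff_fam.comp (contDiff_const.prodMk contDiff_id)) 1).continuous.continuousOn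
      have e1 : h.fam 1 p₁ 1 = b.heightA p₁ := by
        rw [h.fam_of_lt 1 hp.2.1, h.edge p₁ ⟨le_rfl, by linarith⟩ (fun hh ↦ absurd hh.1 (not_lt.2 (by linarith)))]; rfl
      have e2 : h.fam 1 p₂ 1 = b.heightA p₂ := by
        rw [h.fam_of_gt 1 hp.2.2.2.1, h.edge p₂ ⟨by linarith, le_rfl⟩ (fun hh ↦ absurd hh.2 (not_lt.2 (by linarith)))]; rfl
      have hmono := b.strictMonoOn_heightA.monotoneOn
      have m1 : p₁ ∈ Icc (b.thetaA 10⁻¹) (b.thetaA (9 / 10)) := ⟨by linarith, by linarith⟩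
      have m2 : p₂ ∈ Icc (b.thetaA 10⁻¹) (b.thetaA (9 / 10)) := ⟨by linarith, by linarith⟩
      have hy : b.heightA t ∈ Icc (h.fam 1 p₁ 1) (h.fam 1 p₂ 1) := by
        rw [e1, e2]; exact ⟨hmono m1 htw hts.1, hmono htw m2 hts.2⟩
      obtain ⟨s, hs, hse⟩ := intermediate_value_Icc (by linarith : p₁ ≤ p₂) hcont hy
      refine ⟨circlePt s, ?_⟩
      rw [h.outKnot_circlePt_of_mem hs, ← b.band_pt2_zero_heightA htw]
      rw [← (h.exists_eq_of_apply_zero_eq ⟨zero_le_one, le_rfl⟩ hs (h.fam_one_apply_zero hs)).2]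
      congr 1
      ext i; fin_cases i
      · exact h.fam_one_apply_zero hs
      · exact hse
    · exact ⟨circlePt t, h.outKnot_circlePt_of_not_mem ht hts⟩

/-- **The end knot induces the same orientation as `A`** (they agree near a parameter off the track
interval). [folklore] -/
theorem sameOrientationAt_outKnot : Knot.SameOrientationAt h.outKnot A := by
  have hp := h.hp; have hm := h.margin_le; have hε := h.margin_pos
  -- a parameter strictly between `p₂` and `base + 1`
  set t₀ := (p₂ + (h.base + 1)) / 2 with ht₀
  have ht₀1 : p₂ < t₀ := by rw [ht₀]; linarith
  have ht₀2 : t₀ < h.base + 1 := by rw [ht₀]; linarith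
  have hagree : ∀ t ∈ Ioo p₂ (h.base + 1), h.outKnot (circlePt t) = A (circlePt t) := fun t ht ↦
    h.outKnot_circlePt_of_not_mem ⟨by simp only [base]; linarith [ht.1, hp.1], ht.2⟩ (fun hh ↦ by linarith [hh.2, ht.1])
  refine ⟨2 * π * t₀, 2 * π * t₀, 1, one_pos, ?_, ?_⟩
  · rw [← circlePt_eq_circlePoint]; exact hagree t₀ ⟨ht₀1, ht₀2⟩
  · rw [one_smul]
    apply Filter.EventuallyEq.deriv_eq
    have hπ : 0 < 2 * π := by positivity
    have hopen : IsOpen ((fun θ : ℝ ↦ θ / (2 * π)) ⁻¹' Ioo p₂ (h.base + 1)) := isOpen_Ioo.preimage (continuous_id.div_const _)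
    have hmem : 2 * π * t₀ ∈ (fun θ : ℝ ↦ θ / (2 * π)) ⁻¹' Ioo p₂ (h.base + 1) := by
      show 2 * π * t₀ / (2 * π) ∈ Ioo p₂ (h.base + 1)
      rw [mul_div_cancel_left₀ _ hπ.ne']; exact ⟨ht₀1, ht₀2⟩
    filter_upwards [hopen.mem_nhds hmem] with θ hθ
    have e : circlePoint θ = circlePt (θ / (2 * π)) := by
      rw [circlePt_eq_circlePoint, mul_div_cancel₀ _ hπ.ne']
    rw [e, hagree _ hθ]

/-- **THE EDGE LOOP LEMMA**: an edge loop is isotopic to the first summand `A`.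
[cite: HirschDT1976, Ch. 8 §1, Thm. 1.3] -/
theorem isIsotopic : k.IsIsotopic A :=
  IsAmbientIsotopic.trans_holds h.isIsotopic_outKnot
    (Knot.isIsotopic_of_range_eq_holds h.range_outKnot h.sameOrientationAt_outKnot)

end EdgeLoop



end BandData

end Literature.Topology.FourManifolds
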